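import Summits.Ventures.GridStability.Models.StructurePreservingEdgeFlow
import Literature.MathematicalPhysics.PowerSystems.LurieQuadraticCertificate

/-!
# GridStability/Models/StructurePreservingLurie — the structure-preserving model in angles RELATIVE
# TO A REFERENCE BUS as a Vu–Turitsyn bilinear system `ẋ = Ax − BF(Cx)` satisfying the
# observability condition (model-side companion of the SP / Lur'e certificate lane; object + readings)

LADDER-GRIDFUSION G3 (model register) / G2 «SP–Lur'e lane» (lit-6 2026-08-27T02:23:49Z: «for SP
objects in ABSOLUTE angles `hobs` FAILS (rotation ∈ ker C ∩ ker CA): hand me the object in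
reference-bus coordinates — that is the one modelling step left»), seat gridfusion-model-2 (g5);
`plan/MODEL-VALIDITY.md` row **MV-3** (Bergen–Hill structure-preserving model: lossless lines,
`|V| ≡ 1`, frequency-dependent first-order loads; absent effects listed there). THREE COLUMNS:
MODELLED column only — a typed coordinate form of MODEL MV-3 in the vocabulary of the tree's kernel
theorem [cite: VuTuritsyn2017, §4.3 Theorem 1] (lit-6,
`Literature/MathematicalPhysics/PowerSystems/LurieQuadraticCertificate.lean`); no certificate is
produced or assumed to exist here; nothing says a grid is stable. Companion file
`StructurePreservingLurieRoa.lean`: the field identity with model-2's `Params.phaseField` and the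
transport of Theorem 1 to solutions of MV-3.

## Why a reference bus
[cite: VuTuritsyn2017, §2 (state-space form) and §3 eq. (Bilinear)] write the structure-preserving
model `m_k δ̈_k + d_k δ̇_k + Σ a_kj sin δ_kj = P_k` (generator buses), `d_k δ̇_k + Σ a_kj sin δ_kj = P_k`
(load buses) as `ẋ = Ax − BF(Cx)` in ABSOLUTE angle deviations `x = [δ_G − δ*_G; δ̇_G; δ_L − δ*_L]`
and note (§2) «This point is not unique since any shift in the buses' angles … is also an
equilibrium». The tree's kernel form of their Theorem 1
(`QuadraticCertificate.well_subset_regionOfAttraction`) therefore carries the observability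
hypothesis `Cx = 0 ∧ CAx = 0 ⇒ x = 0`, which the absolute form violates along the rotation
`(𝟙, 0, 𝟙)`. Here the model is written in the `(n − 1) + |gen|` coordinates
`θ_v = (δ_v − δ_r) − (δ*_v − δ*_r)` (`v ≠ r`) and `ω_j = δ̇_{gnode j}` (generators), for a reference
LOAD bus `r` (first-order node, `r ∉ gen`; every Bergen–Hill network bus qualifies
[cite: Padiyar2013, §3.2 eq (3.6) (one bus angle as reference)]): eliminating `δ_r` through its own
load equation `D_r δ̇_r = P_r − f_r(δ)` keeps the bilinear shape — the reference bus's flow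
imbalance enters every `θ̇_v` through `B` — and the rotation is gone.

## Contents (all PROVED; data-independent; `p : Params (k+1)`, edge list `src, tgt, wt` with
`p.b = symmetrize (edgeWeight src tgt wt)` — the shape of every typed instance, e.g. `NE39SP`)
* `edgeInc`, `sum_edgeInc_mul`, `Params.pe_eq_sum_edgeInc`, `Params.pe_sub_pe_eq_sum_edgeInc` —
  oriented incidence of the edge list and the node balance
  `fᵥ(δ) − fᵥ(δ*) = Σ_e inc_e(v)·wt_e·(sin σ_e − sin σ*_e)` (the `EᵀS F` term of the printed form);
* `extRef` (+ lemmas) — extension of a non-reference tuple by `0` at the reference bus;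
* `Params.relLurie p r gnode src tgt wt δ*` — THE OBJECT: lit-6's `LyapunovFunctionFamily.System`
  on states `Fin k ⊕ Fin g` (angle deviations of the `k` non-reference buses `r.succAbove i`
  relative to `r`; frequency deviations of the `g` generators enumerated by `gnode`) and lines
  `Fin m` (the listed edges): `A = [[0, J], [0, −M⁻¹D]]` (`J` reads a generator's speed into its
  angle row), `B = [(1 − 𝟙_gen)D⁻¹E_relᵀW − 𝟙(1/D_r)E_rᵀW ; M⁻¹E_Gᵀ W]`, `C = [E_rel 0]`,
  `δ*_e = δ*_{src e} − δ*_{tgt e}` (it does not depend on `P⁰`: `shifted_relLurie`);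
* `relState r gnode δ* (δ, ω)` — the coordinate map from the MV-3 phase space (`relState_equilibrium`:
  the whole rotation orbit of the equilibrium goes to `0`); `relLurie_C_mulVec(_relState)`,
  `relLurie_nonlin_relState` (`(Cx)_e = σ_e − σ*_e`, `F_e = sin σ_e − sin σ*_e`,
  `σ_e = δ_{src e} − δ_{tgt e}`), `mem_halfPolytope_relState_iff` (the sector polytope = listed line
  angles in `(−π/2, π/2)`), `relLurie_A_mulVec_inl/_inr`, `relLurie_B_mulVec_inl/_inr`;
* `relLurie_obs` — **observability from connectivity**: `Cx = 0 ∧ CAx = 0 ⇒ x = 0` whenever the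
  coupling graph is preconnected, `r ∉ gen` and `gnode` enumerates `gen` injectively — the
  hypothesis `hobs` of `QuadraticCertificate.well_subset_regionOfAttraction`, discharged once for
  every instance of this shape.
MODELLED: absent effects = MODEL-VALIDITY MV-3 (line resistance, voltage dynamics, reactive power,
load voltage-dependence, machine internals); the reference bus is a bookkeeping choice.
-/

noncomputable section

open Finset Real Set Filter Matrix
open scoped Topology
open Literature.MathematicalPhysics.PowerSystems
open Literature.MathematicalPhysics.PowerSystems.LyapunovFunctionFamily

namespace Summit.Ventures.GridStability.Models.StructurePreserving

variable {k g m : ℕ}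

/-! ## Oriented incidence of an indexed edge list and the node balance -/

/-- Oriented incidence number of listed edge `e` at bus `v`: `+1` if `v = src e`, `−1` if
`v = tgt e` (`0` otherwise, and for a self-loop). -/
def edgeInc (src tgt : Fin m → Fin (k + 1)) (e : Fin m) (v : Fin (k + 1)) : ℝ :=
  (if src e = v then 1 else 0) - (if tgt e = v then 1 else 0)

/-- `Σ_v inc_e(v)·φ_v = φ_{src e} − φ_{tgt e}` (a row of the incidence matrix reads a line angle). -/
theorem sum_edgeInc_mul (src tgt : Fin m → Fin (k + 1)) (e : Fin m) (φ : Fin (k + 1) → ℝ) :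
    ∑ v, edgeInc src tgt e v * φ v = φ (src e) - φ (tgt e) := by
  simp only [edgeInc, sub_mul, Finset.sum_sub_distrib, ite_mul, one_mul, zero_mul,
    Finset.sum_ite_eq, Finset.mem_univ, if_true]

/-- `netFlow` is the incidence-weighted sum of the per-edge quantities. -/
theorem netFlow_eq_sum_edgeInc (src tgt : Fin m → Fin (k + 1)) (F : Fin m → ℝ) (v : Fin (k + 1)) :
    netFlow src tgt F v = ∑ e, edgeInc src tgt e v * F e := by
  unfold netFlow edgeInc
  rw [← Finset.sum_sub_distrib]
  refine Finset.sum_congr rfl fun e _ => ?_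
  split_ifs <;> ring

/-- **Node balance in incidence form**: for edge-list couplings,
`fᵥ(δ) = Σ_e inc_e(v)·wt_e·sin(δ_{src e} − δ_{tgt e})` [cite: Padiyar2013, §3.2 eq (3.9)]. -/
theorem Params.pe_eq_sum_edgeInc (p : Params (k + 1)) {src tgt : Fin m → Fin (k + 1)} {wt : Fin m → ℝ}
    (hb : p.b = symmetrize (edgeWeight src tgt wt)) (δ : Fin (k + 1) → ℝ) (v : Fin (k + 1)) :
    p.pe δ v = ∑ e, edgeInc src tgt e v * (wt e * Real.sin (δ (src e) - δ (tgt e))) := by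
  rw [p.pe_eq_netFlow_edgeFlow hb δ v, netFlow_eq_sum_edgeInc]
  rfl

/-- **Injection deviations are driven by the line nonlinearity**:
`fᵥ(δ) − fᵥ(δ*) = Σ_e inc_e(v)·wt_e·(sin σ_e − sin σ*_e)`, `σ_e = δ_{src e} − δ_{tgt e}` — the
`EᵀS F(Cx)` term of [cite: VuTuritsyn2017, §2 (state-space form)]. -/
theorem Params.pe_sub_pe_eq_sum_edgeInc (p : Params (k + 1)) {src tgt : Fin m → Fin (k + 1)}
    {wt : Fin m → ℝ} (hb : p.b = symmetrize (edgeWeight src tgt wt)) (δ δs : Fin (k + 1) → ℝ)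
    (v : Fin (k + 1)) :
    p.pe δ v - p.pe δs v = ∑ e, edgeInc src tgt e v * wt e
      * (Real.sin (δ (src e) - δ (tgt e)) - Real.sin (δs (src e) - δs (tgt e))) := by
  rw [p.pe_eq_sum_edgeInc hb δ v, p.pe_eq_sum_edgeInc hb δs v, ← Finset.sum_sub_distrib]
  refine Finset.sum_congr rfl fun e _ => ?_
  ring

/-! ## Extension of a non-reference tuple by `0` at the reference bus -/

/-- Extend a tuple indexed by the non-reference buses (`r.succAbove i`) by the value `0` at the
reference bus `r`. -/
def extRef (r : Fin (k + 1)) (u : Fin k → ℝ) : Fin (k + 1) → ℝ :=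
  Fin.insertNth (α := fun _ => ℝ) r 0 u

/-- The extension vanishes at the reference bus. -/
@[simp] theorem extRef_same (r : Fin (k + 1)) (u : Fin k → ℝ) : extRef r u r = 0 := by
  simp [extRef]

/-- The extension reads the tuple at the non-reference buses. -/
@[simp] theorem extRef_succAbove (r : Fin (k + 1)) (u : Fin k → ℝ) (i : Fin k) :
    extRef r u (r.succAbove i) = u i := by
  simp [extRef]

/-- A sum over the non-reference buses is the full sum of the extension. -/
theorem sum_succAbove_eq_sum_extRef (r : Fin (k + 1)) (u : Fin k → ℝ) (c : Fin (k + 1) → ℝ) :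
    ∑ i, c (r.succAbove i) * u i = ∑ v, c v * extRef r u v := by
  rw [Fin.sum_univ_succAbove _ r, extRef_same, mul_zero, zero_add]
  simp only [extRef_succAbove]

/-- The extension of `v ↦ φ(r.succAbove v)` is `φ` when `φ r = 0`. -/
theorem extRef_eq_of_apply_eq_zero (r : Fin (k + 1)) {φ : Fin (k + 1) → ℝ} (hφ : φ r = 0) :
    extRef r (fun i => φ (r.succAbove i)) = φ := by
  funext v
  rcases Fin.eq_self_or_eq_succAbove r v with rfl | ⟨i, rfl⟩
  · rw [extRef_same, hφ]
  · rw [extRef_succAbove]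

namespace Params

/-! ## The relative Lur'e (bilinear) system of the structure-preserving model -/

/-- State matrix `A` of the relative form: the angle row of a non-reference GENERATOR bus reads its
speed (`θ̇_v = ω_v + …`), the speed rows carry `−D_v/M_v`; load-bus angle rows and all angle
columns are zero. [cite: VuTuritsyn2017, §3 (display for A)] -/
def relA (p : Params (k + 1)) (r : Fin (k + 1)) (gnode : Fin g → Fin (k + 1)) :
    Matrix (Fin k ⊕ Fin g) (Fin k ⊕ Fin g) ℝ
  | Sum.inl _, Sum.inl _ => 0
  | Sum.inl i, Sum.inr j => if r.succAbove i = gnode j then 1 else 0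
  | Sum.inr _, Sum.inl _ => 0
  | Sum.inr j, Sum.inr j' => if j = j' then -(p.D (gnode j) / p.M (gnode j)) else 0

/-- Input matrix `B` of the relative form: a load-bus angle row carries `inc_e(v)·wt_e/D_v`, EVERY
angle row carries the reference bus's `−inc_e(r)·wt_e/D_r` (elimination of `δ_r` through its load
equation), a speed row carries `inc_e(v)·wt_e/M_v`. [cite: VuTuritsyn2017, §3 (display for B)] -/
def relB (p : Params (k + 1)) (r : Fin (k + 1)) (gnode : Fin g → Fin (k + 1))
    (src tgt : Fin m → Fin (k + 1)) (wt : Fin m → ℝ) : Matrix (Fin k ⊕ Fin g) (Fin m) ℝ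
  | Sum.inl i, e => ((if r.succAbove i ∈ p.gen then 0
      else edgeInc src tgt e (r.succAbove i) / p.D (r.succAbove i)) - edgeInc src tgt e r / p.D r) * wt e
  | Sum.inr j, e => edgeInc src tgt e (gnode j) / p.M (gnode j) * wt e

/-- Output matrix `C = [E_rel 0]`: line `e` reads `θ_{src e} − θ_{tgt e}` with `θ_r ≡ 0`.
[cite: VuTuritsyn2017, §2 (display for C)] -/
def relC (r : Fin (k + 1)) (src tgt : Fin m → Fin (k + 1)) : Matrix (Fin m) (Fin k ⊕ Fin g) ℝ
  | e, Sum.inl i => edgeInc src tgt e (r.succAbove i)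
  | _, Sum.inr _ => 0

/-- **The structure-preserving model relative to the reference load bus `r` as a Vu–Turitsyn
bilinear system** `ẋ = Ax − BF(Cx)`, `F_e = sin(δ*_e + (Cx)_e) − sin δ*_e`, on states
`Fin k ⊕ Fin g` = (relative angle deviations `θ_v = (δ_v − δ_r) − (δ*_v − δ*_r)` of the buses
`v = r.succAbove i`; generator frequency deviations `ω_{gnode j}`) and lines = the listed edges,
equilibrium line angles `δ*_e = δ*_{src e} − δ*_{tgt e}`. MODELLED: MODEL-VALIDITY MV-3; `P⁰ = f(δ*)`
(frame rotating at the synchronous frequency). [cite: VuTuritsyn2017, §3 eq. (Bilinear)];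
[cite: Padiyar2013, §3.2 eqs (3.2), (3.6) (one bus angle as reference)]. -/
def relLurie (p : Params (k + 1)) (r : Fin (k + 1)) (gnode : Fin g → Fin (k + 1))
    (src tgt : Fin m → Fin (k + 1)) (wt : Fin m → ℝ) (δs : Fin (k + 1) → ℝ) :
    LyapunovFunctionFamily.System (Fin k ⊕ Fin g) (Fin m) where
  A := p.relA r gnode
  B := p.relB r gnode src tgt wt
  C := relC r src tgt
  δs := fun e => δs (src e) - δs (tgt e)

/-- The equilibrium line angles of the relative system are the printed `δ*_kj = δ*_k − δ*_j`.
[cite: VuTuritsyn2017, §2 (Assumption: |δ*_kj| ≤ γ < π/2)] -/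
@[simp] theorem relLurie_δs (p : Params (k + 1)) (r : Fin (k + 1)) (gnode : Fin g → Fin (k + 1))
    (src tgt : Fin m → Fin (k + 1)) (wt : Fin m → ℝ) (δs : Fin (k + 1) → ℝ) (e : Fin m) :
    (p.relLurie r gnode src tgt wt δs).δs e = δs (src e) - δs (tgt e) := rfl

/-- The relative system does not see the injected powers: it is the same object for the data in the
frame rotating at the synchronous frequency (`p.shifted`, `P⁰ ↦ P̄`
[cite: Padiyar2013, §3.2 eqs (3.3)–(3.5)]) — one certificate serves both framings. -/
theorem shifted_relLurie (p : Params (k + 1)) (r : Fin (k + 1)) (gnode : Fin g → Fin (k + 1))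
    (src tgt : Fin m → Fin (k + 1)) (wt : Fin m → ℝ) (δs : Fin (k + 1) → ℝ) :
    p.shifted.relLurie r gnode src tgt wt δs = p.relLurie r gnode src tgt wt δs := rfl

end Params

/-- **The coordinate map** from the MV-3 phase space `(δ, ω)` to the relative state:
`θ_i = (δ_{r.succAbove i} − δ_r) − (δ*_{r.succAbove i} − δ*_r)`, `ω_j = ω_{gnode j}`. -/
def relState (r : Fin (k + 1)) (gnode : Fin g → Fin (k + 1)) (δs : Fin (k + 1) → ℝ)
    (z : (Fin (k + 1) → ℝ) × (Fin (k + 1) → ℝ)) : Fin k ⊕ Fin g → ℝ :=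
  Sum.elim (fun i => z.1 (r.succAbove i) - z.1 r - (δs (r.succAbove i) - δs r))
    (fun j => z.2 (gnode j))

/-- Angle component of the relative state. -/
@[simp] theorem relState_inl (r : Fin (k + 1)) (gnode : Fin g → Fin (k + 1))
    (δs : Fin (k + 1) → ℝ) (z : (Fin (k + 1) → ℝ) × (Fin (k + 1) → ℝ)) (i : Fin k) :
    relState r gnode δs z (Sum.inl i)
      = z.1 (r.succAbove i) - z.1 r - (δs (r.succAbove i) - δs r) := rfl

/-- Speed component of the relative state. -/
@[simp] theorem relState_inr (r : Fin (k + 1)) (gnode : Fin g → Fin (k + 1))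
    (δs : Fin (k + 1) → ℝ) (z : (Fin (k + 1) → ℝ) × (Fin (k + 1) → ℝ)) (j : Fin g) :
    relState r gnode δs z (Sum.inr j) = z.2 (gnode j) := rfl

/-- The relative state of the equilibrium phase point `(δ* + c·𝟙, ω)` with zero generator
frequencies is `0` (every point of the rotation orbit is sent to the origin). -/
theorem relState_equilibrium (r : Fin (k + 1)) (gnode : Fin g → Fin (k + 1))
    (δs : Fin (k + 1) → ℝ) (c : ℝ) {ω : Fin (k + 1) → ℝ} (hω : ∀ j, ω (gnode j) = 0) :
    relState r gnode δs (fun v => δs v + c, ω) = 0 := by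
  funext a
  rcases a with i | j
  · simp only [relState_inl, Pi.zero_apply]; ring
  · simp only [relState_inr, Pi.zero_apply, hω j]

namespace Params

variable (p : Params (k + 1)) (r : Fin (k + 1)) (gnode : Fin g → Fin (k + 1))
  (src tgt : Fin m → Fin (k + 1)) (wt : Fin m → ℝ) (δs : Fin (k + 1) → ℝ)

/-! ### Reading the matrices -/

/-- `(Cx)_e = Σ_i inc_e(r.succAbove i)·θ_i = θ̃_{src e} − θ̃_{tgt e}`, `θ̃` the extension of the angle
block by `θ̃_r = 0`. -/
theorem relLurie_C_mulVec (x : Fin k ⊕ Fin g → ℝ) (e : Fin m) :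
    ((p.relLurie r gnode src tgt wt δs).C *ᵥ x) e
      = extRef r (fun i => x (Sum.inl i)) (src e) - extRef r (fun i => x (Sum.inl i)) (tgt e) := by
  rw [← sum_edgeInc_mul src tgt e, ← sum_succAbove_eq_sum_extRef]
  simp [relLurie, relC, Matrix.mulVec, dotProduct, Fintype.sum_sum_type]

/-- On a relative state, line `e` reads the line-angle deviation:
`(C·relState(δ, ω))_e = (δ_{src e} − δ_{tgt e}) − (δ*_{src e} − δ*_{tgt e})`. -/
theorem relLurie_C_mulVec_relState (z : (Fin (k + 1) → ℝ) × (Fin (k + 1) → ℝ)) (e : Fin m) :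
    ((p.relLurie r gnode src tgt wt δs).C *ᵥ relState r gnode δs z) e
      = (z.1 (src e) - z.1 (tgt e)) - (δs (src e) - δs (tgt e)) := by
  rw [relLurie_C_mulVec]
  have h : extRef r (fun i => relState r gnode δs z (Sum.inl i))
      = fun v => z.1 v - z.1 r - (δs v - δs r) := by
    have := extRef_eq_of_apply_eq_zero r (φ := fun v => z.1 v - z.1 r - (δs v - δs r))
      (by simp)
    simpa only [relState_inl] using this
  rw [h]
  ring

/-- On a relative state the nonlinearity is the printed one:
`F_e = sin(δ_{src e} − δ_{tgt e}) − sin(δ*_{src e} − δ*_{tgt e})`. [cite: VuTuritsyn2017, §2 (display for F)] -/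
theorem relLurie_nonlin_relState (z : (Fin (k + 1) → ℝ) × (Fin (k + 1) → ℝ)) (e : Fin m) :
    (p.relLurie r gnode src tgt wt δs).nonlin (relState r gnode δs z) e
      = Real.sin (z.1 (src e) - z.1 (tgt e)) - Real.sin (δs (src e) - δs (tgt e)) := by
  rw [LyapunovFunctionFamily.System.nonlin, relLurie_C_mulVec_relState]
  simp only [relLurie]
  ring_nf

/-- **The sector polytope in MV-3 terms**: `relState(δ, ω) ∈ 𝒫°` iff every LISTED line angle lies in
`(−π/2, π/2)`. [cite: VuTuritsyn2017, §4.1 (polytope 𝒫)] -/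
theorem mem_halfPolytope_relState_iff (z : (Fin (k + 1) → ℝ) × (Fin (k + 1) → ℝ)) :
    relState r gnode δs z ∈ (p.relLurie r gnode src tgt wt δs).halfPolytope
      ↔ ∀ e, |z.1 (src e) - z.1 (tgt e)| < π / 2 := by
  simp only [LyapunovFunctionFamily.System.halfPolytope, Set.mem_setOf_eq,
    relLurie_C_mulVec_relState]
  refine forall_congr' fun e => ?_
  rw [show (p.relLurie r gnode src tgt wt δs).δs e = δs (src e) - δs (tgt e) from rfl,
    add_sub_cancel]

/-- `(Ax)` on an angle row: the matching generator speed (a sum over the enumeration). -/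
theorem relLurie_A_mulVec_inl (x : Fin k ⊕ Fin g → ℝ) (i : Fin k) :
    ((p.relLurie r gnode src tgt wt δs).A *ᵥ x) (Sum.inl i)
      = ∑ j, if r.succAbove i = gnode j then x (Sum.inr j) else 0 := by
  simp [relLurie, relA, Matrix.mulVec, dotProduct, Fintype.sum_sum_type]

/-- `(Ax)` on a speed row: `−(D_v/M_v)·ω_v`. -/
theorem relLurie_A_mulVec_inr (x : Fin k ⊕ Fin g → ℝ) (j : Fin g) :
    ((p.relLurie r gnode src tgt wt δs).A *ᵥ x) (Sum.inr j)
      = -(p.D (gnode j) / p.M (gnode j)) * x (Sum.inr j) := by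
  simp [relLurie, relA, Matrix.mulVec, dotProduct, Fintype.sum_sum_type]

/-- `(BF)` on an angle row. -/
theorem relLurie_B_mulVec_inl (F : Fin m → ℝ) (i : Fin k) :
    ((p.relLurie r gnode src tgt wt δs).B *ᵥ F) (Sum.inl i)
      = ∑ e, ((if r.succAbove i ∈ p.gen then 0
          else edgeInc src tgt e (r.succAbove i) / p.D (r.succAbove i)) - edgeInc src tgt e r / p.D r)
          * wt e * F e := by
  simp [relLurie, relB, Matrix.mulVec, dotProduct]

/-- `(BF)` on a speed row. -/
theorem relLurie_B_mulVec_inr (F : Fin m → ℝ) (j : Fin g) :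
    ((p.relLurie r gnode src tgt wt δs).B *ᵥ F) (Sum.inr j)
      = ∑ e, edgeInc src tgt e (gnode j) / p.M (gnode j) * wt e * F e := by
  simp [relLurie, relB, Matrix.mulVec, dotProduct]

/-- The enumeration sum on an angle row of a GENERATOR bus is that bus's speed (injective
enumeration). -/
theorem sum_ite_eq_of_injective {gnode : Fin g → Fin (k + 1)} (hginj : Function.Injective gnode)
    (x : Fin k ⊕ Fin g → ℝ) {v : Fin (k + 1)} {j₀ : Fin g} (hj₀ : gnode j₀ = v) :
    (∑ j, if v = gnode j then x (Sum.inr j) else 0) = x (Sum.inr j₀) := by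
  rw [Finset.sum_eq_single j₀]
  · rw [if_pos hj₀.symm]
  · intro j _ hj
    rw [if_neg]
    intro h
    exact hj (hginj (h.symm.trans hj₀.symm))
  · intro h; exact absurd (Finset.mem_univ _) h

/-- The enumeration sum on an angle row of a LOAD bus vanishes. -/
theorem sum_ite_eq_zero_of_not_mem_range {gnode : Fin g → Fin (k + 1)} (x : Fin k ⊕ Fin g → ℝ)
    {v : Fin (k + 1)} (hv : ∀ j, gnode j ≠ v) :
    (∑ j, if v = gnode j then x (Sum.inr j) else 0) = 0 :=
  Finset.sum_eq_zero fun j _ => by rw [if_neg fun h => hv j h.symm]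

/-! ### Observability from connectivity -/

variable {p r gnode src tgt wt δs}

/-- If a tuple on the non-reference buses, extended by `0` at `r`, takes equal values at the two
ends of every listed edge, it vanishes — provided the coupling graph of `p` (edges = listed pairs
with nonzero coupling) is preconnected. -/
theorem eq_zero_of_extRef_edges (hb : p.b = symmetrize (edgeWeight src tgt wt))
    (hconn : p.couplingGraph.Preconnected) {u : Fin k → ℝ}
    (hu : ∀ e, extRef r u (src e) = extRef r u (tgt e)) : u = 0 := by
  have hadj : ∀ i j, p.couplingGraph.Adj i j → extRef r u i = extRef r u j := by
    intro i j hij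
    have hne : symmetrize (edgeWeight src tgt wt) i j ≠ 0 := by rw [← hb]; exact hij.2.1
    obtain ⟨e, he⟩ := exists_edge_of_symmetrize_ne_zero hne
    rcases he with ⟨hs, ht⟩ | ⟨hs, ht⟩
    · rw [← hs, ← ht]; exact hu e
    · rw [← hs, ← ht]; exact (hu e).symm
  funext i
  have h := p.eq_of_reachable hadj (hconn (r.succAbove i) r)
  rwa [extRef_succAbove, extRef_same] at h

/-- **The observability condition holds for the relative form**: `Cx = 0 ∧ CAx = 0 ⇒ x = 0`
whenever the coupling graph is preconnected, `r ∉ gen` and `gnode` enumerates `gen` injectively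
(`Cx = 0` kills the angle block by connectivity through the reference bus; then `CAx = E_rel·(Jω)`
kills the speeds). [cite: VuTuritsyn2017, Appendix 7.2 (convergence to the equilibrium point)] -/
theorem relLurie_obs (hr : r ∉ p.gen) (hginj : Function.Injective gnode)
    (hgen : ∀ v, v ∈ p.gen ↔ ∃ j, gnode j = v)
    (hb : p.b = symmetrize (edgeWeight src tgt wt)) (hconn : p.couplingGraph.Preconnected)
    (x : Fin k ⊕ Fin g → ℝ) (h1 : (p.relLurie r gnode src tgt wt δs).C *ᵥ x = 0)
    (h2 : (p.relLurie r gnode src tgt wt δs).C *ᵥ ((p.relLurie r gnode src tgt wt δs).A *ᵥ x) = 0) :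
    x = 0 := by
  -- angle block
  have hθ : (fun i => x (Sum.inl i)) = 0 := by
    refine eq_zero_of_extRef_edges (r := r) hb hconn fun e => ?_
    have := congrFun h1 e
    rw [relLurie_C_mulVec, Pi.zero_apply] at this
    linarith
  -- speed block via the angle rows of `Ax`
  set u : Fin k → ℝ := fun i => ((p.relLurie r gnode src tgt wt δs).A *ᵥ x) (Sum.inl i) with hu
  have hu0 : u = 0 := by
    refine eq_zero_of_extRef_edges (r := r) hb hconn fun e => ?_
    have := congrFun h2 e
    rw [relLurie_C_mulVec, Pi.zero_apply] at this
    linarith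
  funext a
  rcases a with i | j
  · exact congrFun hθ i
  · have hvg : gnode j ∈ p.gen := (hgen _).2 ⟨j, rfl⟩
    have hne : gnode j ≠ r := fun h => hr (h ▸ hvg)
    obtain ⟨i, hi⟩ := Fin.exists_succAbove_eq hne
    have hui : ((p.relLurie r gnode src tgt wt δs).A *ᵥ x) (Sum.inl i) = 0 := by
      simpa [hu] using congrFun hu0 i
    rwa [relLurie_A_mulVec_inl, sum_ite_eq_of_injective hginj x hi.symm] at hui

end Params

end Summit.Ventures.GridStability.Models.StructurePreserving

end
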